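import Summits.QuantumFields.YangMills.Theorems.UnitScaleTiltProp7PosOfGaugeFixed
import Summits.QuantumFields.YangMills.Theorems.UnitScaleTiltProp7NestedMeanParallelLift
import Summits.QuantumFields.YangMills.Theorems.UnitScaleTiltProp7NestedMeanTowerClosenessPlug
import HarnessLib

/-!
# Route `UnitScaleTilt`, crux «MinimiserStabilityRegPr» (stmt-QuantumFields-19200, stub EX), node N06(d = 3), route (α) — **THE QUANTITATIVE COERCIVITY ROW FOR
# `Δ_a(U₀)` UNDER THE LIFT ANTECEDENT OF RECORD NEEDS THE GAUGE-FIXED SLICE ROW ONLY**: the residual-gauge floor of [Balaban1985BackgroundPropagators] Thm 3.11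
# («`G′ = (Δ′_a)⁻¹` positive», (3.24)–(3.25)) in its CORRECT mod-`ker D` form `μ‖D_{U₀}λ‖² ≤ ‖Δ^η_{U₀}λ‖²` on `N_S(U₀)` is a TREE THEOREM with `μ = ½` on `𝔘_k(ε₀)`,
# `10¹²L³ε₀ ≤ 1`, whenever every `Ū₀`-parallel coarse section lifts to a `U₀`-parallel fine one (`Lift`, the antecedent of record of LIFT-THREAD 2)

Cell `ym3-torus` (HUMAN RULING D-0037, YM ladder rung R3 — YM₃ on T³ is a RUNG, NOT d = 4, NOT the Clay problem; the YM mass gap is NOT proved).  Fleet lead seat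
`ym-ust-19200-p1` (gen 22), positivity-block lane of the EX face.  THEOREMS ONLY (0 `def`, 0 `sorry`); `--supports stmt-QuantumFields-19200 --as helper`; count-neutral.  Composes
✓`Prop7PosOfGaugeFixed` ((3.118) split), ★px20 ✓`Prop7NestedMeanParallelLift.hHZ_of_parallelLift`, ★px11∕px20 ✓`Prop7NestedMeanTowerCloseness.normSq_toL2S_le_two_mul_of_nsTop_eq_zero`.
LOCATED (this seat, kernel read of ✓p731635 §7).  ✓`Prop7PosOfGaugeFixed.coercive_laplaceA_DeltaOneP_of_gaugeFixed` displays `hNS : ∀ l ∈ N_S(U₀), μ‖l‖² ≤ ‖D_{U₀}l‖²` with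
`0 < μ` — UNINHABITABLE at every background (`toL2S 1 ∈ N_S(U₀) ∩ ker D_{U₀}`, §2 `not_exists_normFloor_NS`); its proof USES only the gradient floor `μ‖D_{U₀}λ‖² ≤ ‖Δ^η_{U₀}λ‖²`
(insensitive to `ker D_{U₀}`) — §1 re-states the row with it, §3 PROVES it under `Lift`.
THE PRINT.  [Balaban1985BackgroundPropagators] (3.24)–(3.25) p. 394 `Δ′_a = Δ^η_U + Q′*aQ′`, `G′ = (Δ′_a)⁻¹`; Thm 3.11 p. 416 *«Δ′_a, G′, (Q′G′²Q′*)⁻¹, Δ_a, G are positive definite»*;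
(3.118)–(3.120) p. 419 *«A = A′ + Dλ, λ = G′RD*A … ⟨A, Δ_πA⟩ = ⟨A′, ΔA′⟩»*; (3.21) p. 394; (3.115) p. 418.  [Balaban1985Averaging] (97) p. 32 (block Poincaré).
WHAT IS PROVED (ns `…Theorems.Prop7CoerciveOfGaugeFixedLift`; member `F n K`, `h : n ≤ K`, weights `c₀ cB > 0`, `0 ≤ a`, any J-term slot `T_J`).
* §1 ★★ `coercive_laplaceA_DeltaOneP_of_gradFloor` — EVERY `U₀`: slice floor `γ` on `{R_S D* A = 0}` + gradient floor `μ` on `N_S(U₀)` ⟹ `(min γ μ ∕ 2)‖x‖² ≤ re⟨x, Δ_a(U₀)x⟩`.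
* §2 `DL2_toL2S_one`, ★ `toL2S_one_mem_NS`, `toL2S_one_ne_zero`, ★★ `not_exists_normFloor_NS` — the located `¬` (any background, any weights).
* §3 ★★ `normFloor_modKer_NS_of_lift` (mod-`ker D` Poincaré row) and ★★★ `gradFloor_NS_of_lift` — `RegPr F n K ε₀ U₀`, `10¹²L³ε₀ ≤ 1`, `Lift` ⟹ `∀ l ∈ N_S, ½‖Dl‖² ≤ ‖Δ^η l‖²`.
* §4 ★★★ `coercive_laplaceA_DeltaOneP_of_gaugeFixed_of_lift` (+ ★★ `…_piSlot_…` for `Δ_πᴾ`, ★★ `…_slotJ_…` for `Δ₁ᴾ`) — under `RegPr` + `Lift` the coercivity row from the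
  gauge-fixed slice row ALONE, constant `min γ ½ ∕ 2` (member-uniform if `γ` is).
* §5 ★★ `coerciveRow_DeltaOneP_of_gaugeFixedRow_lift` ∕ ★★ `coerciveRow_piSlot_of_gaugeFixedRow_lift` — family-level rows in the EX face's letters (`Lift` opaque + one row
  `hLiftRec : Lift L i U₀ → ⟨lifting predicate of record⟩` = the text of ✓`Prop7IrrLiftRowOfRecord.hIrrLift_of_record`; `Lift L i U₀ →` after `ρ ≤ αcap L →`; window `10¹²L³·αcap L ≤ 1`).
* §6 ★ `gaugeFixedFloor_of_coercive_laplaceA_DeltaOneP` (quantitative converse, every `U₀`) and ★★ `gaugeFixedFloor_one_piSlot` — THE FLAT CERTIFICATE of the slice row ((c3) of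
  ★★OWNER RULING g28-№13): at `U₀ = 1`, `a = a₀·(c₀∕cB)·(L^(K−n))³`, floor `γ = 1∕(4·Cst 3 a₀)` (✓`Prop7LaplaceAFlatCoercive.coercive_laplaceA_one_piSlot`, [Balaban1984PropagatorsI] (1.90)).
EFFECT (numbers, not adjectives): of the two inputs of the quantitative Thm 3.11 row (slice floor `γ`, residual-gauge floor `μ`), ONE (`μ`) is discharged under `Lift` with the
explicit value `½`, uniformly in the member; `Lift` itself is ✓`hIrrLift_of_record` at an irreducible datum and ★px20 ✓`hLift_of_flat` at `U₀ = 1`.  What a supplier still owes for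
these slots at a lifted regular background is the GAUGE-FIXED SLICE FLOOR `γ` (LOCATE-RCORE-w4g8 (γ)∕(δ): Thm 3.3-class) — nothing on `N_S`.
HONEST SCOPE.  Linear algebra over landed rows; no estimate of print is proved; `hPosπ`, `hPos₁`, `hPosΔ`, the other print rows, `hThm2S`, EX, the crux are NOT proved;
nothing continuum ∕ OS ∕ mass-gap ∕ Clay.

References: T. Bałaban, CMP **99** (1985) 389–434 [Balaban1985BackgroundPropagators] ((3.21)–(3.25) p.394, (3.115) p.418, (3.118)–(3.122) pp.419–420, Thm 3.11 p.416,
Thm 3.3 p.399); CMP **98** (1985) 17–51 [Balaban1985Averaging] ((97) p.32); CMP **102** (1985) 277–309 [Balaban1985Variational] ((2) p.278, (79) p.290, (141)–(142) p.299);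
CMP **95** (1984) 17–40 [Balaban1984PropagatorsI] (Prop. 1.1 (1.90) p.33).
-/

set_option autoImplicit false

noncomputable section

open scoped InnerProductSpace ComplexConjugate Matrix.Norms.L2Operator BigOperators

namespace Summit.QuantumFields.YangMills.Theorems.Prop7CoerciveOfGaugeFixedLift

open Literature.MathematicalPhysics.QuantumFieldTheory.Balaban1983to89
open Literature.MathematicalPhysics.QuantumFieldTheory.Balaban1983to89.T3ContinuumYM3Torus
open Literature.MathematicalPhysics.QuantumFieldTheory.Balaban1983to89.T3PrintedRegularMinimiser (RegPr)
open Literature.MathematicalPhysics.QuantumFieldTheory.Balaban1983to89.T3Thm1Carrier (Idx)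
open T4Continuum BlockAveraging
open T3SectALandauChart (eta eta_pos bgUnits)
open B9Eq311L2Pairing (WL2)
open B11Eq103H1Complex (SiteL2K BondL2K)
open B7Eq78Linearization (conjR conjR_apply conjR_one)
open B7Prop1Explicit (disp)
open B10Eq27TorusAxialLog (holT transl)
open B7TransferAnalyticMean (meanCLM)
open B15DeterminingSets (embIter)
open Summit.QuantumFields.YangMills.Theorems.Prop8Chart (emlIterU)
open Summit.QuantumFields.YangMills.Theorems.Prop7SectET3Transport (periodsT3)
open Summit.QuantumFields.YangMills.Theorems.Prop7SectET3HilbertLetters (W₂ QL2 DL2 DstarL2 toL2S covLapSite inner_covLapSite)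
open Summit.QuantumFields.YangMills.Theorems.Prop7SectET3GaugeProjector (NS RS mem_NS_iff)
open Summit.QuantumFields.YangMills.Theorems.Prop7SectET3WilsonHessian (DeltaEta)
open Summit.QuantumFields.YangMills.Theorems.Prop7SectET3CurvedPropagators (Qk laplaceA)
open Summit.QuantumFields.YangMills.Theorems.Prop7SectET3DeltaPiPInv (gaugeCorrP DeltaPiSlotP)
open Summit.QuantumFields.YangMills.Theorems.Prop7SectET3DeltaOnePInv (DeltaOneP TJSlotP DeltaOnePJ DeltaOneP_zero)
open Summit.QuantumFields.YangMills.Theorems.Prop7PosOfGaugeFixed (exists_gauge_decomposition Qk_gaugeCorrP RS_DstarL2_gaugeCorrP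
  re_inner_laplaceA_DeltaOneP sq_norm_DL2_le_covLapSite)
open Summit.QuantumFields.YangMills.Theorems.Prop7NestedMeanParallelLift (hHZ_of_parallelLift DL2_toL2S_eq_zero_of_parallel)
open Summit.QuantumFields.YangMills.Theorems.Prop7NestedMeanTowerCloseness (normSq_toL2S_le_two_mul_of_nsTop_eq_zero)

variable {F : T3Family} {n K : ℕ} {h : n ≤ K} {c₀ cB a : ℝ} [Fact (0 < c₀)] [Fact (0 < cB)]

/-! ## §1 The coercivity row with the INHABITABLE residual-gauge hypothesis (gradient floor on `N_S`, mod `ker D`) -/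

/-- ★★ **THE COERCIVITY ROW FOR `Δ_a` FROM THE SLICE FLOOR AND THE GRADIENT FLOOR ON `N_S`** (every background `U₀`, `0 ≤ a`, any J-term slot `T_J`): if
`γ‖A‖² ≤ re⟨A, (Δ^η + T_J)A⟩ + a‖Q_kA‖²` on `{R_S D* A = 0}` and `μ‖D_{U₀}λ‖² ≤ ‖Δ^η_{U₀}λ‖²` for `λ ∈ N_S(U₀)` (`0 ≤ γ`, `0 ≤ μ`), then
`(min γ μ ∕ 2)·‖x‖² ≤ re⟨x, Δ_a(U₀)x⟩` for ALL `x` — ✓`coercive_laplaceA_DeltaOneP_of_gaugeFixed` with its `hNS` replaced by the consequence the proof uses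
(`x = Pᴾx + Dλ`, `‖x‖² ≤ 2‖Pᴾx‖² + 2‖Dλ‖²`, `‖R_S D* x‖² = ‖Δ^ηλ‖²`). [cite: Balaban1985BackgroundPropagators, Thm 3.11 p.416, (3.118)–(3.122) pp.419–420, (3.24)–(3.25) p.394] -/
theorem coercive_laplaceA_DeltaOneP_of_gradFloor (ha : 0 ≤ a)
    (TJ : GaugeField (F.P K) 0 (Matrix.specialUnitaryGroup (Fin 2) ℂ) → (BondL2K ℂ 3 (periodsT3 F K) c₀ W₂ →ₗ[ℂ] BondL2K ℂ 3 (periodsT3 F K) c₀ W₂))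
    (U₀ : GaugeField (F.P K) 0 (Matrix.specialUnitaryGroup (Fin 2) ℂ)) {γ μ : ℝ} (hγ : 0 ≤ γ) (hμ : 0 ≤ μ)
    (hgf : ∀ A : BondL2K ℂ 3 (periodsT3 F K) c₀ W₂, RS F n K h c₀ cB U₀ (DstarL2 F n K c₀ U₀ A) = 0 →
      γ * ‖A‖ ^ 2 ≤ RCLike.re ⟪A, DeltaEta F n K c₀ U₀ A + TJ U₀ A⟫_ℂ + a * ‖Qk F n K h c₀ cB U₀ A‖ ^ 2)
    (hNS : ∀ l ∈ NS F n K h c₀ cB U₀, μ * ‖DL2 F n K c₀ U₀ l‖ ^ 2 ≤ ‖covLapSite F n K c₀ U₀ l‖ ^ 2) :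
    ∀ x : BondL2K ℂ 3 (periodsT3 F K) c₀ W₂,
      min γ μ / 2 * ‖x‖ ^ 2 ≤ RCLike.re ⟪x, laplaceA F n K h c₀ cB a (DeltaOneP F n K h c₀ cB a TJ) U₀ x⟫_ℂ := by
  intro x
  rw [re_inner_laplaceA_DeltaOneP TJ U₀ x]
  obtain ⟨l, hl, hxd, hR⟩ := exists_gauge_decomposition (h := h) (cB := cB) ha U₀ x
  have h1 := hgf (gaugeCorrP F n K h c₀ cB a U₀ x) (RS_DstarL2_gaugeCorrP ha U₀ x)
  rw [Qk_gaugeCorrP ha U₀ x] at h1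
  have h2 : μ * ‖DL2 F n K c₀ U₀ l‖ ^ 2 ≤ ‖RS F n K h c₀ cB U₀ (DstarL2 F n K c₀ U₀ x)‖ ^ 2 := by
    rw [hR]; exact hNS l hl
  have h3 : ‖x‖ ^ 2 ≤ 2 * ‖gaugeCorrP F n K h c₀ cB a U₀ x‖ ^ 2 + 2 * ‖DL2 F n K c₀ U₀ l‖ ^ 2 := by
    have htri := norm_add_le (gaugeCorrP F n K h c₀ cB a U₀ x) (DL2 F n K c₀ U₀ l)
    rw [← hxd] at htri
    nlinarith [norm_nonneg (gaugeCorrP F n K h c₀ cB a U₀ x), norm_nonneg (DL2 F n K c₀ U₀ l), norm_nonneg x,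
      sq_nonneg (‖gaugeCorrP F n K h c₀ cB a U₀ x‖ - ‖DL2 F n K c₀ U₀ l‖)]
  have hm1 : min γ μ ≤ γ := min_le_left _ _
  have hm2 : min γ μ ≤ μ := min_le_right _ _
  have hm0 : 0 ≤ min γ μ := le_min hγ hμ
  calc min γ μ / 2 * ‖x‖ ^ 2
      ≤ min γ μ / 2 * (2 * ‖gaugeCorrP F n K h c₀ cB a U₀ x‖ ^ 2 + 2 * ‖DL2 F n K c₀ U₀ l‖ ^ 2) :=
        mul_le_mul_of_nonneg_left h3 (by positivity)
    _ = min γ μ * ‖gaugeCorrP F n K h c₀ cB a U₀ x‖ ^ 2 + min γ μ * ‖DL2 F n K c₀ U₀ l‖ ^ 2 := by ring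
    _ ≤ γ * ‖gaugeCorrP F n K h c₀ cB a U₀ x‖ ^ 2 + μ * ‖DL2 F n K c₀ U₀ l‖ ^ 2 :=
        add_le_add (mul_le_mul_of_nonneg_right hm1 (sq_nonneg _)) (mul_le_mul_of_nonneg_right hm2 (sq_nonneg _))
    _ ≤ (RCLike.re ⟪gaugeCorrP F n K h c₀ cB a U₀ x,
            DeltaEta F n K c₀ U₀ (gaugeCorrP F n K h c₀ cB a U₀ x) + TJ U₀ (gaugeCorrP F n K h c₀ cB a U₀ x)⟫_ℂ
          + a * ‖Qk F n K h c₀ cB U₀ x‖ ^ 2) + ‖RS F n K h c₀ cB U₀ (DstarL2 F n K c₀ U₀ x)‖ ^ 2 := add_le_add h1 h2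
    _ = _ := by ring

/-! ## §2 The located `¬`: ✓p731635's norm floor on `N_S` is uninhabitable (`toL2S 1 ∈ N_S ∩ ker D`) -/

omit [Fact (0 < cB)] in
/-- **THE CONSTANT SECTION `1` HAS `D_{U₀}(toL2S 1) = 0`** (it is `U₀`-parallel: `U 1 U⁻¹ = 1`). [cite: Balaban1985BackgroundPropagators, (3.3) p.391] -/
theorem DL2_toL2S_one (U₀ : GaugeField (F.P K) 0 (Matrix.specialUnitaryGroup (Fin 2) ℂ)) :
    DL2 F n K c₀ U₀ (toL2S F K c₀ (fun _ => (1 : Matrix (Fin 2) (Fin 2) ℂ))) = 0 :=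
  DL2_toL2S_eq_zero_of_parallel F U₀ _ (fun _ => conjR_one _)

omit [Fact (0 < cB)] in
/-- ★ **THE CONSTANT SECTION `1` LIES IN THE RESIDUAL GAUGE ALGEBRA `N_S(U₀)`** (every background, every weights): `Q(U₀)(D_{U₀} 1) = Q(U₀) 0 = 0`.
[cite: Balaban1985BackgroundPropagators, (3.21) p.394, (3.115) p.418] -/
theorem toL2S_one_mem_NS (U₀ : GaugeField (F.P K) 0 (Matrix.specialUnitaryGroup (Fin 2) ℂ)) :
    toL2S F K c₀ (fun _ => (1 : Matrix (Fin 2) (Fin 2) ℂ)) ∈ NS F n K h c₀ cB U₀ := by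
  rw [mem_NS_iff, DL2_toL2S_one, map_zero]

omit [Fact (0 < c₀)] [Fact (0 < cB)] in
/-- The constant section `1` is a non-zero vector of the weighted `L²` space of gauge parameters. [folklore] -/
theorem toL2S_one_ne_zero : toL2S F K c₀ (fun _ => (1 : Matrix (Fin 2) (Fin 2) ℂ)) ≠ 0 := by
  intro h0
  have h1 : (fun _ : Site (F.P K) 0 => (1 : Matrix (Fin 2) (Fin 2) ℂ)) = 0 := (LinearEquiv.map_eq_zero_iff _).1 h0
  have h2 := congrFun h1 default
  exact one_ne_zero h2

omit [Fact (0 < cB)] in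
/-- ★★ **LOCATED `¬`: NO POSITIVE NORM FLOOR OF `D_{U₀}` ON `N_S(U₀)`** — the hypothesis `hNS : ∀ l ∈ N_S, μ‖l‖² ≤ ‖D_{U₀}l‖²` of
✓`Prop7PosOfGaugeFixed.coercive_laplaceA_DeltaOneP_of_gaugeFixed` admits no `μ > 0`, at ANY background and weights (`l := toL2S 1`).  The correct floor is the gradient
floor of §1, mod `ker D_{U₀}`. [cite: Balaban1985BackgroundPropagators, (3.21) p.394, (3.24)–(3.25) p.394] -/
theorem not_exists_normFloor_NS (U₀ : GaugeField (F.P K) 0 (Matrix.specialUnitaryGroup (Fin 2) ℂ)) :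
    ¬ ∃ μ : ℝ, 0 < μ ∧ ∀ l ∈ NS F n K h c₀ cB U₀, μ * ‖l‖ ^ 2 ≤ ‖DL2 F n K c₀ U₀ l‖ ^ 2 := by
  rintro ⟨μ, hμ, hfl⟩
  have h1 := hfl _ (toL2S_one_mem_NS (h := h) (cB := cB) U₀)
  rw [DL2_toL2S_one, norm_zero, zero_pow two_ne_zero] at h1
  have h2 : 0 < μ * ‖toL2S F K c₀ (fun _ => (1 : Matrix (Fin 2) (Fin 2) ℂ))‖ ^ 2 :=
    mul_pos hμ (pow_pos (norm_pos_iff.2 toL2S_one_ne_zero) 2)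
  linarith

/-! ## §3 The gradient floor on `N_S(U₀)` IS A THEOREM under the lift antecedent: `½‖D_{U₀}λ‖² ≤ ‖Δ^η_{U₀}λ‖²` -/

section Lift

variable (F)

omit [Fact (0 < cB)] in
/-- ★★ **THE MOD-`ker D` POINCARÉ ROW ON `N_S(U₀)` UNDER `Lift`**: `U₀ ∈ 𝔘_k(ε₀)` (`RegPr`, `10¹²L³ε₀ ≤ 1`) and every `Ū₀`-parallel coarse section lifting to a
`U₀`-parallel fine section ⟹ every `λ` with `toL2S λ ∈ N_S(U₀)` differs from a `U₀`-parallel `λ₀` (`D_{U₀}(toL2S λ₀) = 0`) by a section of norm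
`‖toL2S(λ − λ₀)‖² ≤ 2‖D_{U₀}(toL2S λ)‖²` — the honest form of «`G′` bounded on the pure-gauge modes» at the member (★px20's (H-Z) row ∘ ★px11∕px20's block Poincaré on the
zero-top-mean sector). [cite: Balaban1985BackgroundPropagators, (3.21) p.394, (3.24)–(3.25) p.394, Thm 3.11 p.416; Balaban1985Averaging, (97) p.32] -/
theorem normFloor_modKer_NS_of_lift (h : n ≤ K) {ε₀ : ℝ} (hε₀ : 0 < ε₀) (hWε : 10 ^ 12 * (F.L : ℝ) ^ 3 * ε₀ ≤ 1)
    (U₀ : GaugeField (F.P K) 0 (Matrix.specialUnitaryGroup (Fin 2) ℂ)) (hreg : RegPr F n K ε₀ U₀)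
    (hLift : ∀ cf : Site (F.P K) (K - n) → Matrix (Fin 2) (Fin 2) ℂ,
      (∀ e : PBond (F.P K) (K - n), cf e.src = ((emlIterU (K - n) (bgUnits F K U₀) e : (Matrix (Fin 2) (Fin 2) ℂ)ˣ) : Matrix (Fin 2) (Fin 2) ℂ) * cf e.tgt *
        (((emlIterU (K - n) (bgUnits F K U₀) e)⁻¹ : (Matrix (Fin 2) (Fin 2) ℂ)ˣ) : Matrix (Fin 2) (Fin 2) ℂ)) →
      ∃ l₀ : Site (F.P K) 0 → Matrix (Fin 2) (Fin 2) ℂ,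
        (∀ b : PBond (F.P K) 0, l₀ b.src = ((bgUnits F K U₀ b : (Matrix (Fin 2) (Fin 2) ℂ)ˣ) : Matrix (Fin 2) (Fin 2) ℂ) * l₀ b.tgt * (((bgUnits F K U₀ b)⁻¹ : (Matrix (Fin 2) (Fin 2) ℂ)ˣ) : Matrix (Fin 2) (Fin 2) ℂ)) ∧
        ∀ y : Site (F.P K) (K - n), l₀ (embIter (K - n) y) = cf y) :
    ∀ l : Site (F.P K) 0 → Matrix (Fin 2) (Fin 2) ℂ, toL2S F K c₀ l ∈ NS F n K h c₀ cB U₀ →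
      ∃ l₁ : Site (F.P K) 0 → Matrix (Fin 2) (Fin 2) ℂ, toL2S F K c₀ l₁ ∈ NS F n K h c₀ cB U₀ ∧
        DL2 F n K c₀ U₀ (toL2S F K c₀ (l - l₁)) = 0 ∧
        DL2 F n K c₀ U₀ (toL2S F K c₀ l₁) = DL2 F n K c₀ U₀ (toL2S F K c₀ l) ∧
        ‖toL2S F K c₀ l₁‖ ^ 2 ≤ 2 * ‖DL2 F n K c₀ U₀ (toL2S F K c₀ l)‖ ^ 2 := by
  intro l hl
  have hε7 : 10 ^ 7 * (F.L : ℝ) ^ 3 * ε₀ ≤ 1 := by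
    have hL3 : (0 : ℝ) ≤ (F.L : ℝ) ^ 3 * ε₀ := by positivity
    nlinarith
  obtain ⟨l₁, hl₁, ⟨ns, h0, hsucc, hker⟩, hD⟩ := hHZ_of_parallelLift F h hε₀ hWε U₀ hreg hLift l hl
  refine ⟨l₁, hl₁, ?_, hD, ?_⟩
  · rw [map_sub, map_sub, hD, sub_self]
  · rw [← hD]
    exact normSq_toL2S_le_two_mul_of_nsTop_eq_zero F hε₀ hε7 U₀ hreg ns l₁ h0 hsucc hker

omit [Fact (0 < cB)] in
/-- ★★★ **THE GRADIENT FLOOR ON `N_S(U₀)` UNDER THE LIFT ANTECEDENT** — the residual-gauge input of the quantitative Thm 3.11 row is a THEOREM: `U₀ ∈ 𝔘_k(ε₀)`,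
`10¹²L³ε₀ ≤ 1`, `Lift` ⟹ `∀ l ∈ N_S(U₀), ½‖D_{U₀}l‖² ≤ ‖Δ^η_{U₀}l‖²` (`l = toL2S λ`; `λ₁` of `normFloor_modKer_NS_of_lift` has the same `Dλ` AND the same `Δ^ηλ = D*Dλ`, and
`½‖λ₁‖² ≤ ‖Dλ₁‖²` passes to the gradient by ✓`sq_norm_DL2_le_covLapSite`).  Member-uniform constant `½`.
[cite: Balaban1985BackgroundPropagators, (3.23)–(3.25) p.394, Thm 3.11 p.416; Balaban1985Averaging, (97) p.32] -/
theorem gradFloor_NS_of_lift (h : n ≤ K) {ε₀ : ℝ} (hε₀ : 0 < ε₀) (hWε : 10 ^ 12 * (F.L : ℝ) ^ 3 * ε₀ ≤ 1)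
    (U₀ : GaugeField (F.P K) 0 (Matrix.specialUnitaryGroup (Fin 2) ℂ)) (hreg : RegPr F n K ε₀ U₀)
    (hLift : ∀ cf : Site (F.P K) (K - n) → Matrix (Fin 2) (Fin 2) ℂ,
      (∀ e : PBond (F.P K) (K - n), cf e.src = ((emlIterU (K - n) (bgUnits F K U₀) e : (Matrix (Fin 2) (Fin 2) ℂ)ˣ) : Matrix (Fin 2) (Fin 2) ℂ) * cf e.tgt *
        (((emlIterU (K - n) (bgUnits F K U₀) e)⁻¹ : (Matrix (Fin 2) (Fin 2) ℂ)ˣ) : Matrix (Fin 2) (Fin 2) ℂ)) →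
      ∃ l₀ : Site (F.P K) 0 → Matrix (Fin 2) (Fin 2) ℂ,
        (∀ b : PBond (F.P K) 0, l₀ b.src = ((bgUnits F K U₀ b : (Matrix (Fin 2) (Fin 2) ℂ)ˣ) : Matrix (Fin 2) (Fin 2) ℂ) * l₀ b.tgt * (((bgUnits F K U₀ b)⁻¹ : (Matrix (Fin 2) (Fin 2) ℂ)ˣ) : Matrix (Fin 2) (Fin 2) ℂ)) ∧
        ∀ y : Site (F.P K) (K - n), l₀ (embIter (K - n) y) = cf y) :
    ∀ l ∈ NS F n K h c₀ cB U₀, (1 / 2 : ℝ) * ‖DL2 F n K c₀ U₀ l‖ ^ 2 ≤ ‖covLapSite F n K c₀ U₀ l‖ ^ 2 := by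
  -- read `l ∈ SiteL2K` on the route carriers: `l = toL2S λ`
  suffices hS : ∀ lam : Site (F.P K) 0 → Matrix (Fin 2) (Fin 2) ℂ, toL2S F K c₀ lam ∈ NS F n K h c₀ cB U₀ →
      (1 / 2 : ℝ) * ‖DL2 F n K c₀ U₀ (toL2S F K c₀ lam)‖ ^ 2 ≤ ‖covLapSite F n K c₀ U₀ (toL2S F K c₀ lam)‖ ^ 2 by
    intro l hl
    have hl' : toL2S F K c₀ ((toL2S F K c₀).symm l) = l := LinearEquiv.apply_symm_apply _ _
    have h1 := hS ((toL2S F K c₀).symm l) (by rw [hl']; exact hl)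
    rw [hl'] at h1
    exact h1
  intro lam hl
  obtain ⟨l₁, -, -, hD, hP⟩ := normFloor_modKer_NS_of_lift F h hε₀ hWε U₀ hreg hLift lam hl
  -- `½‖λ₁‖² ≤ ‖Dλ₁‖²` ⟹ `½‖Dλ₁‖² ≤ ‖Δ^ηλ₁‖²`, and `Dλ₁ = Dλ`, `Δ^ηλ₁ = D*Dλ₁ = Δ^ηλ`
  have hco : (1 / 2 : ℝ) * ‖toL2S F K c₀ l₁‖ ^ 2 ≤ ‖DL2 F n K c₀ U₀ (toL2S F K c₀ l₁)‖ ^ 2 := by rw [hD]; linarith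
  have h1 := sq_norm_DL2_le_covLapSite (n := n) U₀ (by norm_num : (0 : ℝ) < 1 / 2) hco
  have hcov : covLapSite F n K c₀ U₀ (toL2S F K c₀ l₁) = covLapSite F n K c₀ U₀ (toL2S F K c₀ lam) := by
    have e₁ : covLapSite F n K c₀ U₀ (toL2S F K c₀ l₁) = DstarL2 F n K c₀ U₀ (DL2 F n K c₀ U₀ (toL2S F K c₀ l₁)) := rfl
    have e₂ : covLapSite F n K c₀ U₀ (toL2S F K c₀ lam) = DstarL2 F n K c₀ U₀ (DL2 F n K c₀ U₀ (toL2S F K c₀ lam)) := rfl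
    rw [e₁, e₂, hD]
  rw [hD, hcov] at h1
  exact h1

/-! ## §4 The coercivity row under `Lift`: the gauge-fixed slice floor ALONE suffices -/

/-- ★★★ **UNDER THE LIFT ANTECEDENT, THE QUANTITATIVE THM 3.11 ROW FOR `Δ_a(Δ₁ᴾ(T_J))(U₀)` NEEDS THE GAUGE-FIXED SLICE FLOOR ONLY**: `U₀ ∈ 𝔘_k(ε₀)` (`RegPr`,
`10¹²L³ε₀ ≤ 1`), `Lift`, `0 ≤ a`, any J-term slot `T_J`, and `γ‖A‖² ≤ re⟨A, (Δ^η + T_J)A⟩ + a‖Q_kA‖²` on `{R_S(U₀) D*_{U₀} A = 0}` (`0 ≤ γ`) ⟹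
`(min γ ½ ∕ 2)·‖x‖² ≤ re⟨x, Δ_a(U₀)x⟩` for ALL `x` (§1 with `μ := ½` from §3).  The constant depends on `γ` only — member-uniform if `γ` is.
[cite: Balaban1985BackgroundPropagators, Thm 3.11 p.416, (3.118)–(3.122) pp.419–420, (3.24)–(3.25) p.394; Balaban1985Variational, (141)–(142) p.299] -/
theorem coercive_laplaceA_DeltaOneP_of_gaugeFixed_of_lift (h : n ≤ K) {ε₀ : ℝ} (hε₀ : 0 < ε₀) (hWε : 10 ^ 12 * (F.L : ℝ) ^ 3 * ε₀ ≤ 1) (ha : 0 ≤ a)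
    (TJ : GaugeField (F.P K) 0 (Matrix.specialUnitaryGroup (Fin 2) ℂ) → (BondL2K ℂ 3 (periodsT3 F K) c₀ W₂ →ₗ[ℂ] BondL2K ℂ 3 (periodsT3 F K) c₀ W₂))
    (U₀ : GaugeField (F.P K) 0 (Matrix.specialUnitaryGroup (Fin 2) ℂ)) (hreg : RegPr F n K ε₀ U₀)
    (hLift : ∀ cf : Site (F.P K) (K - n) → Matrix (Fin 2) (Fin 2) ℂ,
      (∀ e : PBond (F.P K) (K - n), cf e.src = ((emlIterU (K - n) (bgUnits F K U₀) e : (Matrix (Fin 2) (Fin 2) ℂ)ˣ) : Matrix (Fin 2) (Fin 2) ℂ) * cf e.tgt *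
        (((emlIterU (K - n) (bgUnits F K U₀) e)⁻¹ : (Matrix (Fin 2) (Fin 2) ℂ)ˣ) : Matrix (Fin 2) (Fin 2) ℂ)) →
      ∃ l₀ : Site (F.P K) 0 → Matrix (Fin 2) (Fin 2) ℂ,
        (∀ b : PBond (F.P K) 0, l₀ b.src = ((bgUnits F K U₀ b : (Matrix (Fin 2) (Fin 2) ℂ)ˣ) : Matrix (Fin 2) (Fin 2) ℂ) * l₀ b.tgt * (((bgUnits F K U₀ b)⁻¹ : (Matrix (Fin 2) (Fin 2) ℂ)ˣ) : Matrix (Fin 2) (Fin 2) ℂ)) ∧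
        ∀ y : Site (F.P K) (K - n), l₀ (embIter (K - n) y) = cf y)
    {γ : ℝ} (hγ : 0 ≤ γ)
    (hgf : ∀ A : BondL2K ℂ 3 (periodsT3 F K) c₀ W₂, RS F n K h c₀ cB U₀ (DstarL2 F n K c₀ U₀ A) = 0 →
      γ * ‖A‖ ^ 2 ≤ RCLike.re ⟪A, DeltaEta F n K c₀ U₀ A + TJ U₀ A⟫_ℂ + a * ‖Qk F n K h c₀ cB U₀ A‖ ^ 2) :
    ∀ x : BondL2K ℂ 3 (periodsT3 F K) c₀ W₂,
      min γ (1 / 2) / 2 * ‖x‖ ^ 2 ≤ RCLike.re ⟪x, laplaceA F n K h c₀ cB a (DeltaOneP F n K h c₀ cB a TJ) U₀ x⟫_ℂ :=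
  coercive_laplaceA_DeltaOneP_of_gradFloor (h := h) ha TJ U₀ hγ (by norm_num) hgf (gradFloor_NS_of_lift F h hε₀ hWε U₀ hreg hLift)

/-- ★★ **THE `hPosπ` SLOT** (`T_J := 0`, `Δ_a = Δ_πᴾ + DR_SD* + Q*aQ`): under `RegPr` + `Lift`, the slice floor `γ‖A‖² ≤ re⟨A, Δ^η(U₀)A⟩ + a‖Q_kA‖²` on `{R_S D* A = 0}` gives
`(min γ ½ ∕ 2)‖x‖² ≤ re⟨x, Δ_a x⟩` for all `x`. [cite: Balaban1985BackgroundPropagators, Thm 3.11 p.416, (3.119)–(3.122) pp.419–420] -/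
theorem coercive_laplaceA_piSlot_of_gaugeFixed_of_lift (h : n ≤ K) {ε₀ : ℝ} (hε₀ : 0 < ε₀) (hWε : 10 ^ 12 * (F.L : ℝ) ^ 3 * ε₀ ≤ 1) (ha : 0 ≤ a)
    (U₀ : GaugeField (F.P K) 0 (Matrix.specialUnitaryGroup (Fin 2) ℂ)) (hreg : RegPr F n K ε₀ U₀)
    (hLift : ∀ cf : Site (F.P K) (K - n) → Matrix (Fin 2) (Fin 2) ℂ,
      (∀ e : PBond (F.P K) (K - n), cf e.src = ((emlIterU (K - n) (bgUnits F K U₀) e : (Matrix (Fin 2) (Fin 2) ℂ)ˣ) : Matrix (Fin 2) (Fin 2) ℂ) * cf e.tgt *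
        (((emlIterU (K - n) (bgUnits F K U₀) e)⁻¹ : (Matrix (Fin 2) (Fin 2) ℂ)ˣ) : Matrix (Fin 2) (Fin 2) ℂ)) →
      ∃ l₀ : Site (F.P K) 0 → Matrix (Fin 2) (Fin 2) ℂ,
        (∀ b : PBond (F.P K) 0, l₀ b.src = ((bgUnits F K U₀ b : (Matrix (Fin 2) (Fin 2) ℂ)ˣ) : Matrix (Fin 2) (Fin 2) ℂ) * l₀ b.tgt * (((bgUnits F K U₀ b)⁻¹ : (Matrix (Fin 2) (Fin 2) ℂ)ˣ) : Matrix (Fin 2) (Fin 2) ℂ)) ∧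
        ∀ y : Site (F.P K) (K - n), l₀ (embIter (K - n) y) = cf y)
    {γ : ℝ} (hγ : 0 ≤ γ)
    (hgf : ∀ A : BondL2K ℂ 3 (periodsT3 F K) c₀ W₂, RS F n K h c₀ cB U₀ (DstarL2 F n K c₀ U₀ A) = 0 →
      γ * ‖A‖ ^ 2 ≤ RCLike.re ⟪A, DeltaEta F n K c₀ U₀ A⟫_ℂ + a * ‖Qk F n K h c₀ cB U₀ A‖ ^ 2) :
    ∀ x : BondL2K ℂ 3 (periodsT3 F K) c₀ W₂,
      min γ (1 / 2) / 2 * ‖x‖ ^ 2 ≤ RCLike.re ⟪x, laplaceA F n K h c₀ cB a (DeltaPiSlotP F n K h c₀ cB a) U₀ x⟫_ℂ := by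
  have e : DeltaPiSlotP F n K h c₀ cB a = DeltaOneP F n K h c₀ cB a (fun _ => 0) := DeltaOneP_zero.symm
  rw [e]
  refine coercive_laplaceA_DeltaOneP_of_gaugeFixed_of_lift F h hε₀ hWε ha (fun _ => 0) U₀ hreg hLift hγ ?_
  intro A hA
  simpa only [LinearMap.zero_apply, add_zero] using hgf A hA

/-- ★★ **THE `hPos₁` SLOT** (`T_J := TJSlotP`, slot `DeltaOnePJ = Pᴾ†(Δ^η + T_J)Pᴾ`): under `RegPr` + `Lift`, the slice floor for `Δ^η + T_J + aQ_k†Q_k` on `{R_S D* A = 0}`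
gives `(min γ ½ ∕ 2)‖x‖² ≤ re⟨x, Δ_{1,a} x⟩` for all `x`. [cite: Balaban1985BackgroundPropagators, (3.127)–(3.130) p.421, Thm 3.11 p.416] -/
theorem coercive_laplaceA_slotJ_of_gaugeFixed_of_lift (h : n ≤ K) {ε₀ : ℝ} (hε₀ : 0 < ε₀) (hWε : 10 ^ 12 * (F.L : ℝ) ^ 3 * ε₀ ≤ 1) (ha : 0 ≤ a)
    (U₀ : GaugeField (F.P K) 0 (Matrix.specialUnitaryGroup (Fin 2) ℂ)) (hreg : RegPr F n K ε₀ U₀)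
    (hLift : ∀ cf : Site (F.P K) (K - n) → Matrix (Fin 2) (Fin 2) ℂ,
      (∀ e : PBond (F.P K) (K - n), cf e.src = ((emlIterU (K - n) (bgUnits F K U₀) e : (Matrix (Fin 2) (Fin 2) ℂ)ˣ) : Matrix (Fin 2) (Fin 2) ℂ) * cf e.tgt *
        (((emlIterU (K - n) (bgUnits F K U₀) e)⁻¹ : (Matrix (Fin 2) (Fin 2) ℂ)ˣ) : Matrix (Fin 2) (Fin 2) ℂ)) →
      ∃ l₀ : Site (F.P K) 0 → Matrix (Fin 2) (Fin 2) ℂ,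
        (∀ b : PBond (F.P K) 0, l₀ b.src = ((bgUnits F K U₀ b : (Matrix (Fin 2) (Fin 2) ℂ)ˣ) : Matrix (Fin 2) (Fin 2) ℂ) * l₀ b.tgt * (((bgUnits F K U₀ b)⁻¹ : (Matrix (Fin 2) (Fin 2) ℂ)ˣ) : Matrix (Fin 2) (Fin 2) ℂ)) ∧
        ∀ y : Site (F.P K) (K - n), l₀ (embIter (K - n) y) = cf y)
    {γ : ℝ} (hγ : 0 ≤ γ)
    (hgf : ∀ A : BondL2K ℂ 3 (periodsT3 F K) c₀ W₂, RS F n K h c₀ cB U₀ (DstarL2 F n K c₀ U₀ A) = 0 →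
      γ * ‖A‖ ^ 2 ≤ RCLike.re ⟪A, DeltaEta F n K c₀ U₀ A + TJSlotP F n K h c₀ cB a U₀ A⟫_ℂ + a * ‖Qk F n K h c₀ cB U₀ A‖ ^ 2) :
    ∀ x : BondL2K ℂ 3 (periodsT3 F K) c₀ W₂,
      min γ (1 / 2) / 2 * ‖x‖ ^ 2 ≤ RCLike.re ⟪x, laplaceA F n K h c₀ cB a (DeltaOnePJ F n K h c₀ cB a) U₀ x⟫_ℂ :=
  coercive_laplaceA_DeltaOneP_of_gaugeFixed_of_lift F h hε₀ hWε ha (TJSlotP F n K h c₀ cB a) U₀ hreg hLift hγ hgf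

end Lift

/-! ## §5 The family-level coercivity row behind the `Lift` antecedent of record, from the gauge-fixed slice row -/

section Family
/-- ★★ **THE QUANTITATIVE COERCIVITY ROW OF THE EX FACE'S LETTERS, BEHIND THE LIFT ANTECEDENT OF RECORD, FROM THE GAUGE-FIXED SLICE ROW ALONE** (any J-term slot
`T_J`, family shape of ✓`Prop7PosOfGaugeFixed.hPos₁_of_gaugeFixedRow`; `Lift` kept OPAQUE as in the LIFT-THREAD displays, read through ONE row `hLiftRec : Lift L i U₀ →
⟨record lifting predicate⟩` — `fun _ _ _ h => h` at `Lift :=` the text of ✓`Prop7IrrLiftRowOfRecord.hIrrLift_of_record`): in the window `10¹²·L³·αcap L ≤ 1`, a slice floor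
`γ L i` on `{R_S D* A = 0}` over `RegPr ρ U₀`, `ρ ≤ αcap L`, gives `(min (γ L i) ½ ∕ 2)·‖x‖² ≤ re⟨x, Δ_a(Δ₁ᴾ(T_J))(U₀) x⟩` for all `x`, behind `Lift L i U₀ →`
(inserted after `ρ ≤ αcap L →`, ★★OWNER RULING №30 (ii)). [cite: Balaban1985BackgroundPropagators, Thm 3.11 p.416, (3.118)–(3.122) pp.419–420, Thm 3.3 p.399; Balaban1985Variational, (141)–(142) p.299] -/
theorem coerciveRow_DeltaOneP_of_gaugeFixedRow_lift
    (Lift : ∀ (L : ℕ) (i : Idx L), GaugeField (i.1.1.P i.1.2.2) 0 (Matrix.specialUnitaryGroup (Fin 2) ℂ) → Prop)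
    (hLiftRec : ∀ (L : ℕ) (i : Idx L) (U₀ : GaugeField (i.1.1.P i.1.2.2) 0 (Matrix.specialUnitaryGroup (Fin 2) ℂ)), Lift L i U₀ →
      ∀ cf : Site (i.1.1.P i.1.2.2) (i.1.2.2 - i.1.2.1) → Matrix (Fin 2) (Fin 2) ℂ,
        (∀ e' : PBond (i.1.1.P i.1.2.2) (i.1.2.2 - i.1.2.1), cf e'.src = ((emlIterU (i.1.2.2 - i.1.2.1) (bgUnits i.1.1 i.1.2.2 U₀) e' : (Matrix (Fin 2) (Fin 2) ℂ)ˣ) : Matrix (Fin 2) (Fin 2) ℂ) * cf e'.tgt *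
          (((emlIterU (i.1.2.2 - i.1.2.1) (bgUnits i.1.1 i.1.2.2 U₀) e')⁻¹ : (Matrix (Fin 2) (Fin 2) ℂ)ˣ) : Matrix (Fin 2) (Fin 2) ℂ)) →
        ∃ l₀ : Site (i.1.1.P i.1.2.2) 0 → Matrix (Fin 2) (Fin 2) ℂ,
          (∀ b' : PBond (i.1.1.P i.1.2.2) 0, l₀ b'.src = ((bgUnits i.1.1 i.1.2.2 U₀ b' : (Matrix (Fin 2) (Fin 2) ℂ)ˣ) : Matrix (Fin 2) (Fin 2) ℂ) * l₀ b'.tgt * (((bgUnits i.1.1 i.1.2.2 U₀ b')⁻¹ : (Matrix (Fin 2) (Fin 2) ℂ)ˣ) : Matrix (Fin 2) (Fin 2) ℂ)) ∧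
          ∀ y : Site (i.1.1.P i.1.2.2) (i.1.2.2 - i.1.2.1), l₀ (embIter (i.1.2.2 - i.1.2.1) y) = cf y)
    (αcap : ℕ → ℝ) (hαcap : ∀ L : ℕ, 1 < L → 0 < αcap L) (hαW : ∀ L : ℕ, 1 < L → 10 ^ 12 * (L : ℝ) ^ 3 * αcap L ≤ 1)
    (c₀ cB : ℕ → ℝ) [hc₀ : ∀ L : ℕ, Fact (0 < c₀ L)] [hcB : ∀ L : ℕ, Fact (0 < cB L)]
    (a : ∀ L : ℕ, Idx L → ℝ) (ha : ∀ (L : ℕ) (i : Idx L), 0 < a L i)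
    (TJ : ∀ (L : ℕ) (i : Idx L), GaugeField (i.1.1.P i.1.2.2) 0 (Matrix.specialUnitaryGroup (Fin 2) ℂ) →
      (BondL2K ℂ 3 (periodsT3 i.1.1 i.1.2.2) (c₀ L) W₂ →ₗ[ℂ] BondL2K ℂ 3 (periodsT3 i.1.1 i.1.2.2) (c₀ L) W₂))
    (γ : ∀ L : ℕ, Idx L → ℝ) (hγ : ∀ (L : ℕ) (i : Idx L), 0 ≤ γ L i)
    (hGF : ∀ (L : ℕ), 1 < L → ∀ (i : Idx L) (U₀ : GaugeField (i.1.1.P i.1.2.2) 0 (Matrix.specialUnitaryGroup (Fin 2) ℂ)), ∀ ρ : ℝ,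
      RegPr i.1.1 i.1.2.1 i.1.2.2 ρ U₀ → ρ ≤ αcap L →
        ∀ A : BondL2K ℂ 3 (periodsT3 i.1.1 i.1.2.2) (c₀ L) W₂,
          RS i.1.1 i.1.2.1 i.1.2.2 i.2.2.le (c₀ L) (cB L) U₀ (DstarL2 i.1.1 i.1.2.1 i.1.2.2 (c₀ L) U₀ A) = 0 →
            γ L i * ‖A‖ ^ 2 ≤ RCLike.re ⟪A, DeltaEta i.1.1 i.1.2.1 i.1.2.2 (c₀ L) U₀ A + TJ L i U₀ A⟫_ℂ
              + a L i * ‖Qk i.1.1 i.1.2.1 i.1.2.2 i.2.2.le (c₀ L) (cB L) U₀ A‖ ^ 2) :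
    ∀ (L : ℕ), 1 < L → ∀ (i : Idx L) (U₀ : GaugeField (i.1.1.P i.1.2.2) 0 (Matrix.specialUnitaryGroup (Fin 2) ℂ)), ∀ ρ : ℝ,
      RegPr i.1.1 i.1.2.1 i.1.2.2 ρ U₀ → ρ ≤ αcap L → Lift L i U₀ →
        ∀ x : BondL2K ℂ 3 (periodsT3 i.1.1 i.1.2.2) (c₀ L) W₂,
          min (γ L i) (1 / 2) / 2 * ‖x‖ ^ 2 ≤ RCLike.re ⟪x, laplaceA i.1.1 i.1.2.1 i.1.2.2 i.2.2.le (c₀ L) (cB L) (a L i)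
            (DeltaOneP i.1.1 i.1.2.1 i.1.2.2 i.2.2.le (c₀ L) (cB L) (a L i) (TJ L i)) U₀ x⟫_ℂ := by
  intro L hL i U₀ ρ hreg hρ hlift
  -- `RegPr ρ ⊆ RegPr (αcap L)` and the window at the member (`i.1.1.L = L`)
  have hreg' : RegPr i.1.1 i.1.2.1 i.1.2.2 (αcap L) U₀ := T3PrintedMinimiserExistence.regPr_mono i.1.1 hρ hreg
  have hW : 10 ^ 12 * (i.1.1.L : ℝ) ^ 3 * αcap L ≤ 1 := by rw [i.2.1]; exact hαW L hL
  exact coercive_laplaceA_DeltaOneP_of_gaugeFixed_of_lift i.1.1 i.2.2.le (hαcap L hL) hW (ha L i).le (TJ L i) U₀ hreg' (hLiftRec L i U₀ hlift)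
    (hγ L i) (fun A hA => hGF L hL i U₀ (αcap L) hreg' le_rfl A hA)

/-- ★★ **THE `hPosπ`-SLOT COERCIVITY ROW BEHIND `Lift`, FROM THE GAUGE-FIXED SLICE ROW** (`T_J := 0`): the quantitative companion of ✓`Prop7PosOfGaugeFixed.hPosπ_of_gaugeFixedRow`.
[cite: Balaban1985BackgroundPropagators, Thm 3.11 p.416, (3.119)–(3.122) pp.419–420] -/
theorem coerciveRow_piSlot_of_gaugeFixedRow_lift
    (Lift : ∀ (L : ℕ) (i : Idx L), GaugeField (i.1.1.P i.1.2.2) 0 (Matrix.specialUnitaryGroup (Fin 2) ℂ) → Prop)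
    (hLiftRec : ∀ (L : ℕ) (i : Idx L) (U₀ : GaugeField (i.1.1.P i.1.2.2) 0 (Matrix.specialUnitaryGroup (Fin 2) ℂ)), Lift L i U₀ →
      ∀ cf : Site (i.1.1.P i.1.2.2) (i.1.2.2 - i.1.2.1) → Matrix (Fin 2) (Fin 2) ℂ,
        (∀ e' : PBond (i.1.1.P i.1.2.2) (i.1.2.2 - i.1.2.1), cf e'.src = ((emlIterU (i.1.2.2 - i.1.2.1) (bgUnits i.1.1 i.1.2.2 U₀) e' : (Matrix (Fin 2) (Fin 2) ℂ)ˣ) : Matrix (Fin 2) (Fin 2) ℂ) * cf e'.tgt *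
          (((emlIterU (i.1.2.2 - i.1.2.1) (bgUnits i.1.1 i.1.2.2 U₀) e')⁻¹ : (Matrix (Fin 2) (Fin 2) ℂ)ˣ) : Matrix (Fin 2) (Fin 2) ℂ)) →
        ∃ l₀ : Site (i.1.1.P i.1.2.2) 0 → Matrix (Fin 2) (Fin 2) ℂ,
          (∀ b' : PBond (i.1.1.P i.1.2.2) 0, l₀ b'.src = ((bgUnits i.1.1 i.1.2.2 U₀ b' : (Matrix (Fin 2) (Fin 2) ℂ)ˣ) : Matrix (Fin 2) (Fin 2) ℂ) * l₀ b'.tgt * (((bgUnits i.1.1 i.1.2.2 U₀ b')⁻¹ : (Matrix (Fin 2) (Fin 2) ℂ)ˣ) : Matrix (Fin 2) (Fin 2) ℂ)) ∧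
          ∀ y : Site (i.1.1.P i.1.2.2) (i.1.2.2 - i.1.2.1), l₀ (embIter (i.1.2.2 - i.1.2.1) y) = cf y)
    (αcap : ℕ → ℝ) (hαcap : ∀ L : ℕ, 1 < L → 0 < αcap L) (hαW : ∀ L : ℕ, 1 < L → 10 ^ 12 * (L : ℝ) ^ 3 * αcap L ≤ 1)
    (c₀ cB : ℕ → ℝ) [hc₀ : ∀ L : ℕ, Fact (0 < c₀ L)] [hcB : ∀ L : ℕ, Fact (0 < cB L)]
    (a : ∀ L : ℕ, Idx L → ℝ) (ha : ∀ (L : ℕ) (i : Idx L), 0 < a L i)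
    (γ : ∀ L : ℕ, Idx L → ℝ) (hγ : ∀ (L : ℕ) (i : Idx L), 0 ≤ γ L i)
    (hGF : ∀ (L : ℕ), 1 < L → ∀ (i : Idx L) (U₀ : GaugeField (i.1.1.P i.1.2.2) 0 (Matrix.specialUnitaryGroup (Fin 2) ℂ)), ∀ ρ : ℝ,
      RegPr i.1.1 i.1.2.1 i.1.2.2 ρ U₀ → ρ ≤ αcap L →
        ∀ A : BondL2K ℂ 3 (periodsT3 i.1.1 i.1.2.2) (c₀ L) W₂,
          RS i.1.1 i.1.2.1 i.1.2.2 i.2.2.le (c₀ L) (cB L) U₀ (DstarL2 i.1.1 i.1.2.1 i.1.2.2 (c₀ L) U₀ A) = 0 →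
            γ L i * ‖A‖ ^ 2 ≤ RCLike.re ⟪A, DeltaEta i.1.1 i.1.2.1 i.1.2.2 (c₀ L) U₀ A⟫_ℂ
              + a L i * ‖Qk i.1.1 i.1.2.1 i.1.2.2 i.2.2.le (c₀ L) (cB L) U₀ A‖ ^ 2) :
    ∀ (L : ℕ), 1 < L → ∀ (i : Idx L) (U₀ : GaugeField (i.1.1.P i.1.2.2) 0 (Matrix.specialUnitaryGroup (Fin 2) ℂ)), ∀ ρ : ℝ,
      RegPr i.1.1 i.1.2.1 i.1.2.2 ρ U₀ → ρ ≤ αcap L → Lift L i U₀ →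
        ∀ x : BondL2K ℂ 3 (periodsT3 i.1.1 i.1.2.2) (c₀ L) W₂,
          min (γ L i) (1 / 2) / 2 * ‖x‖ ^ 2 ≤ RCLike.re ⟪x, laplaceA i.1.1 i.1.2.1 i.1.2.2 i.2.2.le (c₀ L) (cB L) (a L i)
            (DeltaPiSlotP i.1.1 i.1.2.1 i.1.2.2 i.2.2.le (c₀ L) (cB L) (a L i)) U₀ x⟫_ℂ := by
  intro L hL i U₀ ρ hreg hρ hlift
  have hreg' : RegPr i.1.1 i.1.2.1 i.1.2.2 (αcap L) U₀ := T3PrintedMinimiserExistence.regPr_mono i.1.1 hρ hreg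
  have hW : 10 ^ 12 * (i.1.1.L : ℝ) ^ 3 * αcap L ≤ 1 := by rw [i.2.1]; exact hαW L hL
  exact coercive_laplaceA_piSlot_of_gaugeFixed_of_lift i.1.1 i.2.2.le (hαcap L hL) hW (ha L i).le U₀ hreg' (hLiftRec L i U₀ hlift)
    (hγ L i) (fun A hA => hGF L hL i U₀ (αcap L) hreg' le_rfl A hA)

end Family

/-! ## §6 The converse (every background) and the flat certificate of the gauge-fixed slice floor -/
section Converse

/-- ★ **COERCIVITY OF `Δ_a(Δ₁ᴾ(T_J))` ⟹ THE GAUGE-FIXED SLICE FLOOR WITH THE SAME CONSTANT** (every background, the quantitative form of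
✓`Prop7PosOfGaugeFixed.gaugeFixed_pos_of_pos_laplaceA_DeltaOneP`): on `{R_S D* A = 0}` one has `Pᴾ A = A` and the `DR_SD*` penalty vanishes, so
`re⟨A, Δ_a A⟩ = re⟨A, (Δ^η + T_J)A⟩ + a‖Q_kA‖²`. [cite: Balaban1985BackgroundPropagators, (3.119) p.419, (3.122) p.420; Balaban1985Variational, (79) p.290] -/
theorem gaugeFixedFloor_of_coercive_laplaceA_DeltaOneP
    (TJ : GaugeField (F.P K) 0 (Matrix.specialUnitaryGroup (Fin 2) ℂ) → (BondL2K ℂ 3 (periodsT3 F K) c₀ W₂ →ₗ[ℂ] BondL2K ℂ 3 (periodsT3 F K) c₀ W₂))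
    (U₀ : GaugeField (F.P K) 0 (Matrix.specialUnitaryGroup (Fin 2) ℂ)) {γ : ℝ}
    (hco : ∀ x : BondL2K ℂ 3 (periodsT3 F K) c₀ W₂,
      γ * ‖x‖ ^ 2 ≤ RCLike.re ⟪x, laplaceA F n K h c₀ cB a (DeltaOneP F n K h c₀ cB a TJ) U₀ x⟫_ℂ) :
    ∀ A : BondL2K ℂ 3 (periodsT3 F K) c₀ W₂, RS F n K h c₀ cB U₀ (DstarL2 F n K c₀ U₀ A) = 0 →
      γ * ‖A‖ ^ 2 ≤ RCLike.re ⟪A, DeltaEta F n K c₀ U₀ A + TJ U₀ A⟫_ℂ + a * ‖Qk F n K h c₀ cB U₀ A‖ ^ 2 := by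
  intro A hR
  have h1 := hco A
  rw [re_inner_laplaceA_DeltaOneP TJ U₀ A, Prop7Row74AtMember.gaugeCorrP_eq_self_of_landau U₀ hR, hR, norm_zero, zero_pow two_ne_zero, add_zero] at h1
  exact h1

/-- ★★ **THE FLAT CERTIFICATE OF THE GAUGE-FIXED SLICE ROW** ((c3) of ★★OWNER RULING g28-№13 for the hypothesis `hGF` of §4–§5): at `U₀ = 1`, for every `a₀ > 0`, at print's
member-scaled weight `a = a₀·(c₀∕cB)·(L^(K−n))³`, the slice floor holds with the `k`-∕volume-free constant `γ = 1∕(4·Cst 3 a₀)`: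
`γ‖A‖² ≤ re⟨A, Δ^η(1)A⟩ + a‖Q_k(1)A‖²` on `{R_S(1) D* A = 0}` — ✓`Prop7LaplaceAFlatCoercive.coercive_laplaceA_one_piSlot` ([Balaban1984PropagatorsI] (1.90)) read through the converse.
[cite: Balaban1984PropagatorsI, Prop. 1.1 (1.90) p.33; Balaban1985BackgroundPropagators, Thm 3.11 p.416, (3.119)–(3.122) pp.419–420] -/
theorem gaugeFixedFloor_one_piSlot {a₀ : ℝ} (ha₀ : 0 < a₀) :
    ∀ A : BondL2K ℂ 3 (periodsT3 F K) c₀ W₂,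
      RS F n K h c₀ cB 1 (DstarL2 F n K c₀ 1 A) = 0 →
        (1 / (4 * B5Prop11Plancherel.Cst 3 a₀)) * ‖A‖ ^ 2
          ≤ RCLike.re ⟪A, DeltaEta F n K c₀ 1 A⟫_ℂ + (a₀ * (c₀ / cB) * ((F.L : ℝ) ^ (K - n)) ^ 3) * ‖Qk F n K h c₀ cB 1 A‖ ^ 2 := by
  intro A hR
  have e : DeltaPiSlotP F n K h c₀ cB (a₀ * (c₀ / cB) * ((F.L : ℝ) ^ (K - n)) ^ 3)
      = DeltaOneP F n K h c₀ cB (a₀ * (c₀ / cB) * ((F.L : ℝ) ^ (K - n)) ^ 3) (fun _ => 0) := DeltaOneP_zero.symm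
  have hco : ∀ x : BondL2K ℂ 3 (periodsT3 F K) c₀ W₂, (1 / (4 * B5Prop11Plancherel.Cst 3 a₀)) * ‖x‖ ^ 2 ≤
      RCLike.re ⟪x, laplaceA F n K h c₀ cB (a₀ * (c₀ / cB) * ((F.L : ℝ) ^ (K - n)) ^ 3)
        (DeltaOneP F n K h c₀ cB (a₀ * (c₀ / cB) * ((F.L : ℝ) ^ (K - n)) ^ 3) (fun _ => 0)) 1 x⟫_ℂ := fun x => by
    rw [← e]; exact Prop7LaplaceAFlatCoercive.coercive_laplaceA_one_piSlot ha₀ _ x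
  have h1 := gaugeFixedFloor_of_coercive_laplaceA_DeltaOneP (fun _ => 0) 1 hco A hR
  simpa only [LinearMap.zero_apply, add_zero] using h1

end Converse

end Summit.QuantumFields.YangMills.Theorems.Prop7CoerciveOfGaugeFixedLift

end
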